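import Summits.Ventures.HodgeRepro2.T5SU11ResolventL2SchurWeighted

/-!
# The sharp `L²` bound `‖G^I_λ g‖₂ ≤ ‖g‖₂/(λ − 1)²` for every `λ > 1` and every square-integrable source of the class

Row 548's weighted Schur test gives `∫ sinh 2t (G^I_λ g)² ≤ (∫ sinh 2s g²)/(μ − μ′)²` for every `1 < λ′ < λ`, with
`μ − μ′ = λ(λ − 2) − λ′(λ′ − 2)`. Letting `λ′ → 1⁺` (`μ′ → −1`, `μ + 1 = (λ − 1)²`) yields

* `integrableOn_sinh_mul_greenSolI_sq_all` — **`sinh 2t · G^I_λ g(t)²` is integrable on `(0, ∞)` for every `λ > 1`** and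
  every source `g` of the class (rate `ε > 2 − λ`) with `g² sinh 2s ∈ L¹(0, ∞)` (the weight `φ_{(1+λ)/2}`);
* `integral_sinh_mul_greenSolI_sq_le_sharp` — **`∫_{(0,∞)} sinh 2t (G^I_λ g)² ≤ (∫_{(0,∞)} sinh 2s g²)/((λ − 1)²)²`** —
  row 532's sharp constant `1/(λ − 1)² = 1/dist(μ, −ρ²)` (`ρ² = 1` the bottom of the spectrum), now for every
  square-integrable source of the class instead of the sources of rate `ε > 1`;
* `integral_sinh_mul_greenSolI_sq_le_of_two_lt` — for `λ > 2` the two bounds `1/μ` (row 547) and `1/(λ − 1)²` compare as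
  `1/(λ − 1)² < 1/μ`, so the sharp one is the stronger (`(λ − 1)² = μ + 1`).

Nothing is claimed about (N).

Blind lane: Mathlib + the HodgeRepro2 prefix only; no sorry; axioms ⊆ {propext, Classical.choice,
Quot.sound}.
-/

namespace Summit.Ventures.HodgeRepro2.T5SU11ResolventL2Sharp

open Filter Topology MeasureTheory
open Set (Ioi Ioc Ioo)
open T5SU11Cartan T5SU11SphericalFunction T5SU11SphericalDecay T5SU11RadialGreenImproper
  T5SU11ResolventL2SchurWeighted

section measure

variable [MeasurableSpace Circle] [BorelSpace Circle]

variable {lam : ℝ} (hlam : 1 < lam) {g : ℝ → ℝ} (hg : ContinuousOn g (Ioi 0))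
  {M : ℝ} (hM : ∀ s ∈ Ioc (0 : ℝ) 1, |g s| ≤ M) (hM0 : 0 ≤ M)
  {ε C s₀ : ℝ} (hε : 2 - lam < ε) (hC : ∀ s, s₀ ≤ s → |g s| ≤ C * Real.exp (-ε * s))
  (hg2 : IntegrableOn (fun s => Real.sinh (2 * s) * g s ^ 2) (Ioi 0))

include hlam hg hM hM0 hε hC hg2 in
/-- **The resolvent preserves `L²(sinh 2t dt)` for every `λ > 1`** (row 548 with the weight `φ_{(1+λ)/2}`). -/
theorem integrableOn_sinh_mul_greenSolI_sq_all :
    IntegrableOn (fun t => Real.sinh (2 * t) * greenSolI (fun t => sph lam (hyp t)) (sphDecay lam) g t ^ 2) (Ioi 0) :=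
  integrableOn_sinh_mul_greenSolI_sq_weighted hlam (lam' := (1 + lam) / 2) (by linarith) (by linarith) hg hM hM0 hε hC hg2

include hlam hg hM hM0 hε hC hg2 in
/-- **THE SHARP `L²` BOUND FOR EVERY `λ > 1` AND EVERY SQUARE-INTEGRABLE SOURCE OF THE CLASS**:
`∫_{(0,∞)} sinh 2t (G^I_λ g)² ≤ (∫_{(0,∞)} sinh 2s g²)/((λ − 1)²)²` — the limit `λ′ → 1⁺` of row 548's weighted Schur bound
`1/(μ − μ′)²`, since `μ − λ′(λ′ − 2) → μ + 1 = (λ − 1)²`. -/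
theorem integral_sinh_mul_greenSolI_sq_le_sharp :
    ∫ t in Ioi 0, Real.sinh (2 * t) * greenSolI (fun t => sph lam (hyp t)) (sphDecay lam) g t ^ 2
      ≤ (∫ s in Ioi 0, Real.sinh (2 * s) * g s ^ 2) / ((lam - 1) ^ 2) ^ 2 := by
  set X := ∫ t in Ioi 0, Real.sinh (2 * t) * greenSolI (fun t => sph lam (hyp t)) (sphDecay lam) g t ^ 2 with hX
  set Y := ∫ s in Ioi 0, Real.sinh (2 * s) * g s ^ 2 with hY
  -- the bound for every `λ′ ∈ (1, λ)`
  have hbound : ∀ l ∈ Ioo (1 : ℝ) lam, X ≤ Y / (lam * (lam - 2) - l * (l - 2)) ^ 2 := fun l hl =>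
    integral_sinh_mul_greenSolI_sq_le_weighted hlam hl.1 hl.2 hg hM hM0 hε hC hg2
  -- the constant is continuous at `λ′ = 1`, where it equals `Y/((λ − 1)²)²`
  have hden : lam * (lam - 2) - 1 * (1 - 2) = (lam - 1) ^ 2 := by ring
  have hcont : ContinuousAt (fun l : ℝ => Y / (lam * (lam - 2) - l * (l - 2)) ^ 2) 1 := by
    apply ContinuousAt.div continuousAt_const
    · exact (continuousAt_const.sub (continuousAt_id.mul (continuousAt_id.sub continuousAt_const))).pow 2
    · rw [hden]
      exact pow_ne_zero 2 (pow_ne_zero 2 (sub_ne_zero.mpr hlam.ne'))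
  have hf : Tendsto (fun l : ℝ => Y / (lam * (lam - 2) - l * (l - 2)) ^ 2) (𝓝[>] 1)
      (𝓝 (Y / (lam * (lam - 2) - 1 * (1 - 2)) ^ 2)) :=
    tendsto_nhdsWithin_of_tendsto_nhds hcont.tendsto
  have hev : ∀ᶠ l in 𝓝[>] (1 : ℝ), X ≤ Y / (lam * (lam - 2) - l * (l - 2)) ^ 2 :=
    Filter.eventually_of_mem (Ioo_mem_nhdsGT hlam) hbound
  have h := ge_of_tendsto hf hev
  rwa [hden] at h

include hlam hg hM hM0 hε hC hg2 in
/-- For `λ > 2` the sharp bound is the stronger of the two: `(∫ sinh 2s g²)/((λ − 1)²)² ≤ (∫ sinh 2s g²)/μ²`, since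
`(λ − 1)² = μ + 1 > μ`. -/
theorem integral_sinh_mul_greenSolI_sq_le_of_two_lt (h2 : 2 < lam) :
    ∫ t in Ioi 0, Real.sinh (2 * t) * greenSolI (fun t => sph lam (hyp t)) (sphDecay lam) g t ^ 2
      ≤ (∫ s in Ioi 0, Real.sinh (2 * s) * g s ^ 2) / ((lam - 1) ^ 2) ^ 2 ∧
    (∫ s in Ioi 0, Real.sinh (2 * s) * g s ^ 2) / ((lam - 1) ^ 2) ^ 2
      ≤ (∫ s in Ioi 0, Real.sinh (2 * s) * g s ^ 2) / (lam * (lam - 2)) ^ 2 := by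
  refine ⟨integral_sinh_mul_greenSolI_sq_le_sharp hlam hg hM hM0 hε hC hg2, ?_⟩
  have hY : 0 ≤ ∫ s in Ioi 0, Real.sinh (2 * s) * g s ^ 2 :=
    setIntegral_nonneg measurableSet_Ioi (fun s hs =>
      mul_nonneg (Real.sinh_nonneg_iff.mpr (by linarith [Set.mem_Ioi.mp hs])) (sq_nonneg _))
  have hμ : 0 < lam * (lam - 2) := mul_pos (by linarith) (by linarith)
  apply div_le_div_of_nonneg_left hY (pow_pos hμ 2)
  have : lam * (lam - 2) ≤ (lam - 1) ^ 2 := by nlinarith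
  exact pow_le_pow_left₀ hμ.le this 2

end measure

end Summit.Ventures.HodgeRepro2.T5SU11ResolventL2Sharp
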